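/-
Origin: expansion seat `planner-pub-hodgecm-mc-axioms-1-g14-0`, handover #W198 2026-08-20T15:53:55Z md5 7419f2de1885 (PKG 503beb80f396 → 7419f2de1885; 280 l.; MECHANICAL (iib-R) rewrite v3.1 of the PKG file as it stands (16 token edits; rules R1x1+RX[h₂]x15)) (`HOME/mc/pub-hodgecm-mc-axioms-1-g14/revendor/kit-r55/stage55/HodgeCM/Model/Binders/Real34CensusSigma.lean`, md5 7419f2de1885, 280 lines);
landed by the gen-22 packager (p-g22) in gate run 55 REPLACES the earlier landed copy of `HodgeCM/Model/Binders/Real34CensusSigma.lean` (seat copy carried the packager Origin header of an earlier run (stripped)).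
-/
/-
Origin: speedrun cell pub-hodgecm, MODEL-CONSTRUCTION sub-cell, unit pub-hodgecm-mc-binder-1-g13 (BINDER PROVER, gen 13; row 17 `real34`:
the socket of #56 RE-TYPED over binder-2's torus-twisted census `datumAtσ … σ` (RULING S5b (B1′), orientation-34), and at `σ := sigma34 c.D`
with `homg₃₄` ((J-μ)₃₄ ∘ #N4), `hdense` (`hdense_of_hκ`) and `harch` (#68 `harch_datumAtσ`) DISCHARGED), seat prover-pub-hodgecm-mc-binder-1-g13-0, 2026-08-20.
Target in PKG: HodgeCM/Model/Binders/Real34CensusSigma.lean (NEW additive leaf; imports binder-1 #56 `Binders/Real34Census` + #68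
`Binders/Real34HarchPin` and binder-2's RUN-51 #N4 `HypCensus/OmgInsAll34`; needs the S5b table (`datumAtσ`, `printedAtσ`) LANDED).
KERNEL ONLY: 3 def-valued constructors (imports also binder-2's `HypCensus/DenseRange` for `hdense_of_hκ`); 0 records, nothing cited, 0 `def … : Prop`; MODEL-N ±0; E unchanged.
Nothing here is a claim of the manuscripts under adjudication.
-/
import Summits.HodgeConjecture.HodgeCM.Model.Binders.Real34Census
import Summits.HodgeConjecture.HodgeCM.Model.Binders.Real34HarchPin
import Summits.HodgeConjecture.HodgeCM.Model.HypCensus.OmgInsAll34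
import Summits.HodgeConjecture.HodgeCM.Model.HypCensus.DenseRange

/-!
# Row 17's socket over the twisted census `datumAtσ σ`; `harch` and `homg₃₄` discharged

§ 1 `HypCensus.coreW₃₄Ofσ (σ)` — binder-2's S5b literal of `nonempty_hypCoreW₃₄_wmInputCM₂g` (torus twist `σ`) as a term (#56 § 1 at `σ`).
§ 2 **`Gen12PinsP.Real34CensusSideT.ofCensusσ (σ)`** — #56's socket with every census text read at `datumAtσ … σ` / `printedAtσ … σ`
(`σ = 1` is #56 `ofCensus` up to unfolding).
§ 3 **`Gen12PinsP.Real34CensusSideT.ofCensus34`** — at `σ := sigma34 c.D` ((B1′) orientation): `homg₃₄` SUPPLIED by binder-2's #N4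
`omgW_ins₃₄_eq_of_weight` from the (J-μ)₃₄ scalar identity `hμ₃₄` (read at `swapPin c.D u_t`; theta-3's (K14) `hμ₃₄_GOG` at E's pin), `harch`
SUPPLIED by #68 `harch_datumAtσ`, `hdense` SUPPLIED by binder-2's `hdense_of_hκ` ((J-dense) from (V-val)), `Z₂ Z₃ := lineFam …` (carch-1's #CA56/#CA59 literals).
Residual inputs of row 17 per good context: `hκ` ((V-val), row 18; binder-2's `hκ_of_hasArchType_pairType` at E's pin), `hμ₃₄` ((J-μ)₃₄; (K14)),
`hLF₂ hLF₃` (sinst `hLF_P`), `hsupply` ((W-0-supply), carch #CA59), `hpos₂ hpos₃` (the guard, `SInstance.hpos_GOG`).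
-/

set_option autoImplicit false

noncomputable section

open MeasureTheory NumberField MulAction IsDedekindDomain
open scoped NumberField
open scoped Matrix InnerProductSpace TensorProduct Classical SchwartzMap

attribute [-instance] Quotient.instMeasurableSpace

/-! ## 1. binder-2's twisted (34) core as a term -/

namespace HodgeCM.Model.HypCensus

open Filter Topology
open NumberField.InfinitePlace
open Literature.NumberTheory.Automorphic Literature.NumberTheory.Automorphic.UnitaryGroup Literature.NumberTheory.Weil1964
open Literature.RepresentationTheory.KonnoKonno2007 Literature.RepresentationTheory.KonnoKonno2007.RealDualPair
open Literature.NumberTheory.GelbartRogawski1991 Literature.NumberTheory.GelbartRogawski1991.UnitaryDualPair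
open Literature.Analysis.SegalBargmann
open HodgeCM HodgeCM.Model HodgeCM.Adelic
open HodgeCM.PerL34 HodgeCM.PerL34.ArchC HodgeCM.PerL34.Fock HodgeCM.PerL34.Fock.PrintDict
open NumberField.SeesawArchTorus

section Pin

variable {L : CMField} {ι₁ : L →+* ℂ} (V : HermSpace3 L ι₁) (S : StubTree.SeesawDatum L)
variable
  (hGR : (cmSplittingDatum (L : Type) finProdFinEquiv (frameD V) (frameD_real V) (frameD_ne V) (dW S) (dW_real S) (dW_ne S)).CompatibleSplitting)
  (η : CMAdelic (L : Type) (frameD V) × CMAdelic (L : Type) (dW S) →* ℂˣ)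
  (hη : ∀ γU ∈ CMRat (L : Type) (frameD V), ∀ γ ∈ CMRat (L : Type) (dW S), η (γU, γ) = 1)
  (hηc : Continuous fun p => ((η p : ℂˣ) : ℂ))
  (hV : IsAnisotropic L V.Hm)
  (hW : (∀ j, 0 < (ι₁ ((dW S) j)).re) ∨ ∀ j, (ι₁ ((dW S) j)).re < 0)
variable (jD : InfinitePlace (L : Type) → HodgeCM.PerL34.Fock.EqVar → Fin 6) (m₁ m₂ : InfinitePlace (L : Type) → ℤ)
variable (σ : InfinitePlace (L : Type) → Equiv.Perm (Fin 2))
variable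
  (hκ : ∀ k : ↥(KInfty V),
    ((η (kPair V S ι₁ V.sylvesterFrame (sylvesterFrame_formCongr V) k) : ℂˣ) : ℂ) *
        ((pinLetterChar V S hGR hW (kVLetters V S (lett V S k)) : Circle) : ℂ) * dVIota V S (lett V S k (cmPlace (L : Type) ι₁)) =
      ((UnitaryGroup.archKappa (L : Type) V.Hm ι₁ V.sylvesterFrame (sylvesterFrame_formCongr V) k : ℂˣ) : ℂ))

/-- **binder-2's `σ`-twisted (34) census core, as a term**: the structure literal of the S5b `nonempty_hypCoreW₃₄_wmInputCM₂g` (torus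
twist `σ`; `FinIdx := FinSB`, `ins := ins₃₄ … (datumAtσ … σ)`, `omg_ins := homg₃₄`, `dense := dense₃₄_of_dense hdense`, curves `curve₃₄`). -/
def coreW₃₄Ofσ
    (homg₃₄ : ∀ (f : FinSB ↥(maximalRealSubfield L) (Fin 6)) (t : (printedAtσ V S hW jD m₁ m₂ σ).Tg) (φ : (printedAtσ V S hW jD m₁ m₂ σ).F),
      omgW (wmInputCM₂g V S hGR η hη hηc ι₁ V.sylvesterFrame (sylvesterFrame_formCongr V))
          (printedTorusHom (kindOf (L : Type) (frameD V) (frameD_real V) (dW S) (dW_real S) ι₁ (datumAtσ V S jD (jIOf V S hW) σ))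
            (lamOf (L : Type) (frameD V) (frameD_real V) (dW S) (dW_real S) ι₁ (datumAtσ V S jD (jIOf V S hW) σ))
            (lamOf_ne_zero (L : Type) (frameD V) (frameD_real V) (dW S) (dW_real S) ι₁ (datumAtσ V S jD (jIOf V S hW) σ))
            (S.jT₃₄.toMonoidHom.comp (toAdeles (L : Type)))
            (pinnedVacs (kindOf (L : Type) (frameD V) (frameD_real V) (dW S) (dW_real S) ι₁ (datumAtσ V S jD (jIOf V S hW) σ)) m₁ m₂) t)
          (ins₃₄ V S hGR η (datumAtσ V S jD (jIOf V S hW) σ) m₁ m₂ f φ) =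
        ins₃₄ V S hGR η (datumAtσ V S jD (jIOf V S hW) σ) m₁ m₂ f ((printedAtσ V S hW jD m₁ m₂ σ).ωT t φ))
    (hdense : ∀ Φ ∈ (wmInputCM₂g V S hGR η hη hηc ι₁ V.sylvesterFrame (sylvesterFrame_formCongr V)).SK,
      toTop (wmInputCM₂g V S hGR η hη hηc ι₁ V.sylvesterFrame (sylvesterFrame_formCongr V)) Φ ∈
        closure (toTop (wmInputCM₂g V S hGR η hη hηc ι₁ V.sylvesterFrame (sylvesterFrame_formCongr V)) ''
          (Submodule.span ℂ (Set.range fun q : FinSB ↥(maximalRealSubfield L) (Fin 6) × (printedAtσ V S hW jD m₁ m₂ σ).F =>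
            ins (L : Type) (frameD V) (frameD_real V) (frameD_ne V) (dW S) (dW_real S) (dW_ne S) ι₁ (datumAtσ V S jD (jIOf V S hW) σ) m₁ m₂ q.1 q.2) :
              Set (CMSchwartz (L : Type) 6)))) :
    HypCoreW (wmInputCM₂g V S hGR η hη hηc ι₁ V.sylvesterFrame (sylvesterFrame_formCongr V)) S.jT₃₄ m₁ m₂ :=
  { kind := kindOf (L : Type) (frameD V) (frameD_real V) (dW S) (dW_real S) ι₁ (datumAtσ V S jD (jIOf V S hW) σ)
    lam := lamOf (L : Type) (frameD V) (frameD_real V) (dW S) (dW_real S) ι₁ (datumAtσ V S jD (jIOf V S hW) σ)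
    hlam := lamOf_ne_zero (L : Type) (frameD V) (frameD_real V) (dW S) (dW_real S) ι₁ (datumAtσ V S jD (jIOf V S hW) σ)
    side :=
      { FinIdx := FinSB ↥(maximalRealSubfield L) (Fin 6)
        ins := fun f => ins₃₄ V S hGR η (datumAtσ V S jD (jIOf V S hW) σ) m₁ m₂ f
        ins_mem := fun f φ => ins₃₄_mem_SK V S hGR η hη hηc ι₁ V.sylvesterFrame (sylvesterFrame_formCongr V)
          (datumAtσ V S jD (jIOf V S hW) σ) m₁ m₂ hW f φ (ins_mem_datumAt V S hGR η hη hηc hV hW jD m₁ m₂ hκ f φ)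
        dense := dense₃₄_of_dense V S hGR η hη hηc ι₁ V.sylvesterFrame (sylvesterFrame_formCongr V) (datumAtσ V S jD (jIOf V S hW) σ)
          m₁ m₂ hW (FinSB ↥(maximalRealSubfield L) (Fin 6)) id hdense
        omg_ins := homg₃₄
        e := fun b u s => curve₃₄ V S (datumAtσ V S jD (jIOf V S hW) σ) b u s
        e_zero := fun b u => curve₃₄_zero V S (datumAtσ V S jD (jIOf V S hW) σ) b u
        smooth := fun b u f φ => smooth₃₄_wmInputCM₂g V S hGR η hη hηc ι₁ V.sylvesterFrame (sylvesterFrame_formCongr V)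
          (datumAtσ V S jD (jIOf V S hW) σ) m₁ m₂ hW b u f φ } }

end Pin

end HodgeCM.Model.HypCensus

/-! ## 2. The socket over the twisted census; ## 3. at `σ₃₄` with `homg₃₄`, `hdense`, `harch` discharged -/

namespace HodgeCM.Model


open HodgeCM HodgeCM.Universe HodgeCM.Adelic HodgeCM.Model.HypCensus
open HodgeCM.PerL34 HodgeCM.PerL34.Fock HodgeCM.PerL34.Fock.PrintDict HodgeCM.PerL34.Annihilation
open Literature.NumberTheory.Weil1964
open Literature.NumberTheory.Automorphic (piSchwartzBruhat FinSB thinCosetTestFunₗ piSchwartzBruhatEquiv)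
open Literature.NumberTheory.Automorphic.UnitaryGroup (archKappa)
open Literature.NumberTheory.GelbartRogawski1991.UnitaryDualPair
open Literature.AlgebraicGeometry.HodgeTheory
open Literature.AlgebraicGeometry.ShimuraVarieties
open Literature.NumberTheory.Automorphic.PicardCM
open Literature.NumberTheory.Transcendental (Arapura2012_Cor_15_4_6)
open HodgeCM.Model.ThetaSpace HodgeCM.Model.ArchSideTerm HodgeCM.Model.SupplyInstance HodgeCM.Model.SupplyResidual
open NumberField.SeesawArchTorus (toAdeles printedTorusHom printedTorusHom_apply placesEquiv)
open HodgeCM.PerL34.Fock.LocalFock NumberField.SeesawTorus NumberField.SeesawArchTorus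

namespace Gen12PinsP

variable
  (G : ∀ {L : CMField} {ι₁ : L →+* ℂ} (_V : HermSpace3 L ι₁) (_c : SeesawCtx L), Prop)
  (hG : ∀ {L : CMField} {ι₁ : L →+* ℂ} (V : HermSpace3 L ι₁) (c : SeesawCtx L),
    G V c → (∀ j, 0 < (ι₁ (dW c.D j)).re) ∨ ∀ j, (ι₁ (dW c.D j)).re < 0)
  (hGR : ∀ {L : CMField} {ι₁ : L →+* ℂ} (V : HermSpace3 L ι₁) (c : SeesawCtx L),
    (cmSplittingDatum (L : Type) finProdFinEquiv (frameD V) (frameD_real V) (frameD_ne V) (dW c.D) (dW_real c.D)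
      (dW_ne c.D)).CompatibleSplitting)
  (η : ∀ {L : CMField} {ι₁ : L →+* ℂ} (V : HermSpace3 L ι₁) (c : SeesawCtx L),
    CMAdelic (L : Type) (frameD V) × CMAdelic (L : Type) (dW c.D) →* ℂˣ)
  (hη : ∀ {L : CMField} {ι₁ : L →+* ℂ} (V : HermSpace3 L ι₁) (c : SeesawCtx L),
    ∀ γU ∈ CMRat (L : Type) (frameD V), ∀ γ ∈ CMRat (L : Type) (dW c.D), η V c (γU, γ) = 1)
  (hηc : ∀ {L : CMField} {ι₁ : L →+* ℂ} (V : HermSpace3 L ι₁) (c : SeesawCtx L), Continuous fun p => ((η V c p : ℂˣ) : ℂ))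
  (hGR₀ : ∀ {L : CMField} {ι₁ : L →+* ℂ} (V : HermSpace3 L ι₁) (c : SeesawCtx L),
    (cmSplittingDatum (L : Type) (e₁) (frameD V) (frameD_real V) (frameD_ne V) (lineVec (L : Type) (dW c.D 0))
      (fun _ => dW_real c.D 0) (fun _ => dW_ne c.D 0)).CompatibleSplitting)
  (hGR₁ : ∀ {L : CMField} {ι₁ : L →+* ℂ} (V : HermSpace3 L ι₁) (c : SeesawCtx L),
    (cmSplittingDatum (L : Type) (e₁) (frameD V) (frameD_real V) (frameD_ne V) (lineVec (L : Type) (dW c.D 1))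
      (fun _ => dW_real c.D 1) (fun _ => dW_ne c.D 1)).CompatibleSplitting)
  (hGR₂ : ∀ {L : CMField} {ι₁ : L →+* ℂ} (V : HermSpace3 L ι₁) (c : SeesawCtx L),
    (cmSplittingDatum (L : Type) (e₁) (frameD V) (frameD_real V) (frameD_ne V) (lineVec (L : Type) (dW' c.D 0))
      (fun _ => dW'_real c.D 0) (fun _ => dW'_ne c.D 0)).CompatibleSplitting)
  (hGR₃ : ∀ {L : CMField} {ι₁ : L →+* ℂ} (V : HermSpace3 L ι₁) (c : SeesawCtx L),
    (cmSplittingDatum (L : Type) (e₁) (frameD V) (frameD_real V) (frameD_ne V) (lineVec (L : Type) (dW' c.D 1))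
      (fun _ => dW'_real c.D 1) (fun _ => dW'_ne c.D 1)).CompatibleSplitting)
  (AG : ∀ {L : CMField} {ι₁ : L →+* ℂ} (V : HermSpace3 L ι₁) (c : SeesawCtx L), G V c → ∀ k : Fin 4,
    ArchLineInput V (lineRepD V c.D (hGR V c) (hGR₀ V c) (hGR₁ V c) (hGR₂ V c) (hGR₃ V c) (η V c) k))

variable (hHD : exists_isReal_hodgeModel) (hI : hodgePQ_independent_of_hodgeModel)
  (h₁ : BallQuotientUniformised)  (h₃ : CMAbelianVarietyRealised)
  (h : Bool) (hA : Arapura2012_Cor_15_4_6) (μ : ∀ {L : CMField}, SeesawCtx L → Fin 4 → InfinitePlace L → ℤ)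

section Context34

variable {L : CMField} {ι₁ : L →+* ℂ} (V : HermSpace3 L ι₁) (c : SeesawCtx L) (hV : IsAnisotropic L V.Hm)

/-- **THE SOCKET OVER THE `σ`-TWISTED CENSUS** — #56 `Real34CensusSideT.ofCensus` with every census text read at `datumAtσ … σ` /
`printedAtσ … σ` (inputs: rows-18/19 families `hκ`, `homg₃₄`, `hdense`, LF-continuity, (W-0-supply) `hsupply`, the letter identity `harch`). -/
def Real34CensusSideT.ofCensusσ (hW : IsAnisotropic L c.D.gramW) (hs : (∀ j, 0 < (ι₁ (dW c.D j)).re) ∨ ∀ j, (ι₁ (dW c.D j)).re < 0)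
    (jD : InfinitePlace (L : Type) → EqVar → Fin 6) (σ : InfinitePlace (L : Type) → Equiv.Perm (Fin 2))
    (hκ : ∀ k : ↥(KInfty V),
      ((η V c (kPair V c.D ι₁ V.sylvesterFrame (sylvesterFrame_formCongr V) k) : ℂˣ) : ℂ) *
          ((pinLetterChar V c.D (hGR V c) hs (kVLetters V c.D (lett V c.D k)) : Circle) : ℂ) * dVIota V c.D (lett V c.D k (cmPlace (L : Type) ι₁)) =
        ((archKappa (L : Type) V.Hm ι₁ V.sylvesterFrame (sylvesterFrame_formCongr V) k : ℂˣ) : ℂ))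
    (homg₃₄ : ∀ (f : FinSB ↥(maximalRealSubfield L) (Fin 6)) (t : (printedAtσ V c.D hs jD (fun w => -μ c 2 w) (fun w => -μ c 3 w) σ).Tg)
        (φ : (printedAtσ V c.D hs jD (fun w => -μ c 2 w) (fun w => -μ c 3 w) σ).F),
      omgW (Gen12Pins.Wg @hGR @η @hη @hηc @Gen12Pins.τSyl @Gen12Pins.TSyl @Gen12Pins.hTSyl V c)
          (printedTorusHom (kindOf (L : Type) (frameD V) (frameD_real V) (dW c.D) (dW_real c.D) ι₁ (datumAtσ V c.D jD (jIOf V c.D hs) σ))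
            (lamOf (L : Type) (frameD V) (frameD_real V) (dW c.D) (dW_real c.D) ι₁ (datumAtσ V c.D jD (jIOf V c.D hs) σ))
            (lamOf_ne_zero (L : Type) (frameD V) (frameD_real V) (dW c.D) (dW_real c.D) ι₁ (datumAtσ V c.D jD (jIOf V c.D hs) σ))
            (c.D.jT₃₄.toMonoidHom.comp (toAdeles (L : Type)))
            (pinnedVacs (kindOf (L : Type) (frameD V) (frameD_real V) (dW c.D) (dW_real c.D) ι₁ (datumAtσ V c.D jD (jIOf V c.D hs) σ))
              (fun w => -μ c 2 w) (fun w => -μ c 3 w)) t)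
          (ins₃₄ V c.D (hGR V c) (η V c) (datumAtσ V c.D jD (jIOf V c.D hs) σ) (fun w => -μ c 2 w) (fun w => -μ c 3 w) f φ) =
        ins₃₄ V c.D (hGR V c) (η V c) (datumAtσ V c.D jD (jIOf V c.D hs) σ) (fun w => -μ c 2 w) (fun w => -μ c 3 w) f
          ((printedAtσ V c.D hs jD (fun w => -μ c 2 w) (fun w => -μ c 3 w) σ).ωT t φ))
    (hdense : ∀ Φ ∈ (Gen12Pins.Wg @hGR @η @hη @hηc @Gen12Pins.τSyl @Gen12Pins.TSyl @Gen12Pins.hTSyl V c).SK,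
      toTop (Gen12Pins.Wg @hGR @η @hη @hηc @Gen12Pins.τSyl @Gen12Pins.TSyl @Gen12Pins.hTSyl V c) Φ ∈
        closure (toTop (Gen12Pins.Wg @hGR @η @hη @hηc @Gen12Pins.τSyl @Gen12Pins.TSyl @Gen12Pins.hTSyl V c) ''
          (Submodule.span ℂ (Set.range fun q : FinSB ↥(maximalRealSubfield L) (Fin 6) × (printedAtσ V c.D hs jD (fun w => -μ c 2 w) (fun w => -μ c 3 w) σ).F =>
            ins (L : Type) (frameD V) (frameD_real V) (frameD_ne V) (dW c.D) (dW_real c.D) (dW_ne c.D) ι₁ (datumAtσ V c.D jD (jIOf V c.D hs) σ)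
              (fun w => -μ c 2 w) (fun w => -μ c 3 w) q.1 q.2) : Set (CMSchwartz (L : Type) 6))))
    (Z₂ Z₃ : Module.Dual ℂ (thetaSpaceInputIn hHD hI h₁ h₃ ((SInstance.SGP @G @hG @hGR @η @hη @hηc @hGR₀ @hGR₁ @hGR₂ @hGR₃ @AG) V c) hV).W →ₗ[ℂ]
      SchwartzMap ((thetaSpaceInputIn hHD hI h₁ h₃ ((SInstance.SGP @G @hG @hGR @η @hη @hηc @hGR₀ @hGR₁ @hGR₂ @hGR₃ @AG) V c) hV).J →
        mixedEmbedding.mixedSpace (thetaSpaceInputIn hHD hI h₁ h₃ ((SInstance.SGP @G @hG @hGR @η @hη @hηc @hGR₀ @hGR₁ @hGR₂ @hGR₃ @AG) V c) hV).K) ℂ)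
    (hLF₂ : ((thetaSpaceInputIn hHD hI h₁ h₃ ((SInstance.SGP @G @hG @hGR @η @hη @hηc @hGR₀ @hGR₁ @hGR₂ @hGR₃ @AG) V c) hV).P 2).IsLFAction)
    (hLF₃ : ((thetaSpaceInputIn hHD hI h₁ h₃ ((SInstance.SGP @G @hG @hGR @η @hη @hηc @hGR₀ @hGR₁ @hGR₂ @hGR₃ @AG) V c) hV).P 3).IsLFAction)
    (hsupply : ∀ (x₂ x₃ : Fin 3 → FiniteAdeleRing (𝓞 ↥(maximalRealSubfield L)) ↥(maximalRealSubfield L))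
        (𝔫₂ 𝔫₃ : Ideal (𝓞 ↥(maximalRealSubfield L))),
      ∃ (B₂ : ArchKTypeDataAt (thetaSpaceInputIn hHD hI h₁ h₃ ((SInstance.SGP @G @hG @hGR @η @hη @hηc @hGR₀ @hGR₁ @hGR₂ @hGR₃ @AG) V c) hV) 2 x₂ 𝔫₂)
        (B₃ : ArchKTypeDataAt (thetaSpaceInputIn hHD hI h₁ h₃ ((SInstance.SGP @G @hG @hGR @η @hη @hηc @hGR₀ @hGR₁ @hGR₂ @hGR₃ @AG) V c) hV) 3 x₃ 𝔫₃),
        B₃.Γ₀ = B₂.Γ₀ ∧ B₂.Φarch = Z₂ ∧ B₃.Φarch = Z₃ ∧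
          B₂.IsWeaklyPDiff BallForms.expP ∧
          (∀ p : Fin 2, B₂.IsPMinusKilledAlong BallForms.expP (-Complex.I • (Pi.single p 1 : Fin 2 → ℂ))) ∧
          B₃.IsWeaklyPDiff BallForms.expP ∧
          (∀ p : Fin 2, B₃.IsPMinusKilledAlong BallForms.expP (-Complex.I • (Pi.single p 1 : Fin 2 → ℂ))))
    (harch : ∃ (Tinf : SchwartzMap (Fin 3 → mixedEmbedding.mixedSpace ↥(maximalRealSubfield L)) ℂ →
        SchwartzMap (Fin 3 → mixedEmbedding.mixedSpace ↥(maximalRealSubfield L)) ℂ →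
          SchwartzMap (Fin 6 → mixedEmbedding.mixedSpace ↥(maximalRealSubfield L)) ℂ)
        (Tf : FinSB ↥(maximalRealSubfield L) (Fin 3) →ₗ[ℂ] FinSB ↥(maximalRealSubfield L) (Fin 3) →ₗ[ℂ] FinSB ↥(maximalRealSubfield L) (Fin 6)),
      (∀ (Φ₂ Φ₃ : SchwartzMap (Fin 3 → mixedEmbedding.mixedSpace ↥(maximalRealSubfield L)) ℂ) (F₂ F₃ : FinSB ↥(maximalRealSubfield L) (Fin 3)),
        tau34 V c.D (piSchwartzBruhatEquiv ↥(maximalRealSubfield L) (Fin 3) (Φ₂ ⊗ₜ F₂))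
            (piSchwartzBruhatEquiv ↥(maximalRealSubfield L) (Fin 3) (Φ₃ ⊗ₜ F₃)) =
          piSchwartzBruhatEquiv ↥(maximalRealSubfield L) (Fin 6) (Tinf Φ₂ Φ₃ ⊗ₜ Tf F₂ F₃)) ∧
      Submodule.span ℂ (Set.range fun p : FinSB ↥(maximalRealSubfield L) (Fin 3) × FinSB ↥(maximalRealSubfield L) (Fin 3) =>
        Tf p.1 p.2) = ⊤ ∧
      ∃ a : ℂ,
        archVec₃₄ V c.D (hGR V c) (η V c) (datumAtσ V c.D jD (jIOf V c.D hs) σ) (fun w => -μ c 2 w) (fun w => -μ c 3 w)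
            (printedAtσ V c.D hs jD (fun w => -μ c 2 w) (fun w => -μ c 3 w) σ).φ₀ =
          a • (Tinf (Z₂ (LinearMap.proj 0)) (Z₃ (LinearMap.proj 1)) - Tinf (Z₂ (LinearMap.proj 1)) (Z₃ (LinearMap.proj 0)))) :
    Real34CensusSideT @G @hG @hGR @η @hη @hηc @hGR₀ @hGR₁ @hGR₂ @hGR₃ @AG hHD hI h₁ h₃ h hA @μ V c hV :=
  Real34CensusSideT.ofTensorDecomp @G @hG @hGR @η @hη @hηc @hGR₀ @hGR₁ @hGR₂ @hGR₃ @AG hHD hI h₁ h₃ h hA @μ V c hV hW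
    (coreW₃₄Ofσ V c.D (hGR V c) (η V c) (hη V c) (hηc V c) hV hs jD (fun w => -μ c 2 w) (fun w => -μ c 3 w) σ hκ homg₃₄ hdense)
    Z₂ Z₃ hLF₂ hLF₃ hsupply (Classical.choose harch) (Classical.choose (Classical.choose_spec harch))
    (Classical.choose_spec (Classical.choose_spec harch)).1 (Classical.choose_spec (Classical.choose_spec harch)).2.1 _
    (Classical.choose_spec (Classical.choose_spec harch)).2.2 (by
      intro f
      exact ⟨f, ins₃₄_eq_tmul V c.D (hGR V c) (η V c) _ _ _ f _⟩)

/-- **ROW 17's SOCKET AT THE (B1′) ORIENTATION `σ := sigma34 c.D`: `homg₃₄`, `hdense` AND `harch` DISCHARGED, `Z₂ Z₃` THE VACUUM LINE FAMILIES.**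
`homg₃₄` is binder-2's #N4 `omgW_ins₃₄_eq_of_weight` from the (J-μ)₃₄ scalar identity `hμ₃₄` (read at `swapPin c.D u_t`; at E's pin it is
theta-3's (K14) `ArchSideTerm.hμ₃₄_GOG`), `hdense` is binder-2's `hdense_of_hκ` (from the same `hκ`), `harch` is `harch_datumAtσ`,
`Z₂ := lineFam V c.D 0 hpos₂`, `Z₃ := lineFam V c.D 1 hpos₃` (carch-1's #CA56/#CA59 `blockFamilyOfAt … (degOnePDual Empty) (binvPi 1)` literals,
`hpos := (SInstance.hpos_GOG V c hc).2.2.1 ∕ .2.2.2` at E's pin).  Inputs left: `hκ`, `hμ₃₄`, `hpos₂ hpos₃`, `hLF₂ hLF₃`, `hsupply`. -/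
def Real34CensusSideT.ofCensus34 (hW : IsAnisotropic L c.D.gramW) (hs : (∀ j, 0 < (ι₁ (dW c.D j)).re) ∨ ∀ j, (ι₁ (dW c.D j)).re < 0)
    (jD : InfinitePlace (L : Type) → EqVar → Fin 6)
    (hκ : ∀ k : ↥(KInfty V),
      ((η V c (kPair V c.D ι₁ V.sylvesterFrame (sylvesterFrame_formCongr V) k) : ℂˣ) : ℂ) *
          ((pinLetterChar V c.D (hGR V c) hs (kVLetters V c.D (lett V c.D k)) : Circle) : ℂ) * dVIota V c.D (lett V c.D k (cmPlace (L : Type) ι₁)) =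
        ((archKappa (L : Type) V.Hm ι₁ V.sylvesterFrame (sylvesterFrame_formCongr V) k : ℂˣ) : ℂ))
    (hμ₃₄ : ∀ t : (placesAt34 V c.D hs jD (fun w => -μ c 2 w) (fun w => -μ c 3 w)).Tg,
      muScalar34 V c.D (hGR V c) (η V c) hs jD (fun w => -μ c 2 w) (fun w => -μ c 3 w) t *
          dIotaAt (L : Type) (frameD V) (dW c.D) (dW_real c.D) ι₁
            (swapPin c.D (archOf V c.D (datumAtσ V c.D jD (jIOf V c.D hs) (sigma34 c.D)) (fun w => -μ c 2 w) (fun w => -μ c 3 w) t)) =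
        (printPlacesW (InfinitePlace (L : Type))
          (kindOf (L : Type) (frameD V) (frameD_real V) (dW c.D) (dW_real c.D) ι₁ (datumAtσ V c.D jD (jIOf V c.D hs) (sigma34 c.D)))
          (lamOf (L : Type) (frameD V) (frameD_real V) (dW c.D) (dW_real c.D) ι₁ (datumAtσ V c.D jD (jIOf V c.D hs) (sigma34 c.D)))
          (lamOf_ne_zero (L : Type) (frameD V) (frameD_real V) (dW c.D) (dW_real c.D) ι₁ (datumAtσ V c.D jD (jIOf V c.D hs) (sigma34 c.D)))
          (pinnedVacs (kindOf (L : Type) (frameD V) (frameD_real V) (dW c.D) (dW_real c.D) ι₁ (datumAtσ V c.D jD (jIOf V c.D hs) (sigma34 c.D)))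
            (fun w => -μ c 2 w) (fun w => -μ c 3 w)) t)⁻¹)
    (hpos₂ : 0 < cmXW (L : Type) (frameD V) (lineVec (L : Type) (dW' c.D 0)) (fun _ => dW'_real c.D 0) ι₁ (HypCensus.cmPlace (L : Type) ι₁) 0)
    (hpos₃ : 0 < cmXW (L : Type) (frameD V) (lineVec (L : Type) (dW' c.D 1)) (fun _ => dW'_real c.D 1) ι₁ (HypCensus.cmPlace (L : Type) ι₁) 0)
    (hLF₂ : ((thetaSpaceInputIn hHD hI h₁ h₃ ((SInstance.SGP @G @hG @hGR @η @hη @hηc @hGR₀ @hGR₁ @hGR₂ @hGR₃ @AG) V c) hV).P 2).IsLFAction)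
    (hLF₃ : ((thetaSpaceInputIn hHD hI h₁ h₃ ((SInstance.SGP @G @hG @hGR @η @hη @hηc @hGR₀ @hGR₁ @hGR₂ @hGR₃ @AG) V c) hV).P 3).IsLFAction)
    (hsupply : ∀ (x₂ x₃ : Fin 3 → FiniteAdeleRing (𝓞 ↥(maximalRealSubfield L)) ↥(maximalRealSubfield L))
        (𝔫₂ 𝔫₃ : Ideal (𝓞 ↥(maximalRealSubfield L))),
      ∃ (B₂ : ArchKTypeDataAt (thetaSpaceInputIn hHD hI h₁ h₃ ((SInstance.SGP @G @hG @hGR @η @hη @hηc @hGR₀ @hGR₁ @hGR₂ @hGR₃ @AG) V c) hV) 2 x₂ 𝔫₂)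
        (B₃ : ArchKTypeDataAt (thetaSpaceInputIn hHD hI h₁ h₃ ((SInstance.SGP @G @hG @hGR @η @hη @hηc @hGR₀ @hGR₁ @hGR₂ @hGR₃ @AG) V c) hV) 3 x₃ 𝔫₃),
        B₃.Γ₀ = B₂.Γ₀ ∧ B₂.Φarch = lineFam V c.D 0 hpos₂ ∧ B₃.Φarch = lineFam V c.D 1 hpos₃ ∧
          B₂.IsWeaklyPDiff BallForms.expP ∧
          (∀ p : Fin 2, B₂.IsPMinusKilledAlong BallForms.expP (-Complex.I • (Pi.single p 1 : Fin 2 → ℂ))) ∧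
          B₃.IsWeaklyPDiff BallForms.expP ∧
          (∀ p : Fin 2, B₃.IsPMinusKilledAlong BallForms.expP (-Complex.I • (Pi.single p 1 : Fin 2 → ℂ)))) :
    Real34CensusSideT @G @hG @hGR @η @hη @hηc @hGR₀ @hGR₁ @hGR₂ @hGR₃ @AG hHD hI h₁ h₃ h hA @μ V c hV :=
  Real34CensusSideT.ofCensusσ @G @hG @hGR @η @hη @hηc @hGR₀ @hGR₁ @hGR₂ @hGR₃ @AG hHD hI h₁ h₃ h hA @μ V c hV hW hs jD (sigma34 c.D) hκ
    (fun f t φ => omgW_ins₃₄_eq_of_weight V c.D (hGR V c) (η V c) (hη V c) (hηc V c) ι₁ V.sylvesterFrame (sylvesterFrame_formCongr V)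
      hs jD (fun w => -μ c 2 w) (fun w => -μ c 3 w) hμ₃₄ f t φ)
    (hdense_of_hκ V c.D (hGR V c) (η V c) (hη V c) (hηc V c) hs jD (fun w => -μ c 2 w) (fun w => -μ c 3 w) hκ)
    (lineFam V c.D 0 hpos₂) (lineFam V c.D 1 hpos₃) hLF₂ hLF₃ hsupply
    (harch_datumAtσ V c.D hs jD (fun w => -μ c 2 w) (fun w => -μ c 3 w) (sigma34 c.D) (hGR V c) (η V c) hpos₂ hpos₃)

end Context34

end Gen12PinsP

end HodgeCM.Model

end
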